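import Summits.AnomalousDissipation.AnomalousDissipation.Theorems.SolenoidalFractalHomogenisationLagrangianStepOneLevelGlueLowerFamily
import Summits.AnomalousDissipation.AnomalousDissipation.Theorems.SolenoidalFractalHomogenisationLagrangianStepCellClauseCutsW
import HarnessLib

/-!
# K1L `LagrangianRenormalisationStep(Design)` (stmt-AnomalousDissipation-24912 → K1L_D): the PROVED one-sided chain glue through the shape-family
# packages — `chainLower_of_pieces_I` / `_IS` / `_ISW` (helper; `--supports … --as helper`; LANDING LIST F3, part b)

Summits-side helper file of route `SolenoidalFractalHomogenisation` (everything proved; no definitions, no named facts, no sorry).  Landing item F3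
(part b: the glue) of the tenure planner's LANDING MAP (cell `ad-ideate`, tenure D24-2 (c) / D24-3 / D24-4, STATUS 2026-08-28T13:04:46Z) for the crux
workfile `Cruxes/LagrangianRenormalisationStep/IntervalWindowFamilySketch.lean` (planner ad-ideate-p4 g9, commit 78e41dd75007, farm rc 0): the re-plumbed
one-sided chain glue of p629119 `chainLower_of_pieces` through the packages — `chainLower_of_pieces_I` (interval family, §5) and `chainLower_of_pieces_IS`
(sectorial × defect family = the v2 window typing of record, §7), texts VERBATIM (their hypotheses ARE the candidate stub texts `stub_baseT` /
`stub_oneLevelL_I` / the data of `stub_cellLawW_I(S)` and `stub_cellEnergyT`, so no sorry travels; window conjunct and image facts by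
`chainTensorF_nearIso(S)` / `chainImage_nearIso(S)` of part a, existence by `existsL_tensor`, `mstar ↦ max mstar m₁`), plus ONE addition by this seat:
`chainLower_of_pieces_ISW` = `chainLower_of_pieces_IS` with the cell-energy clauses in the WINDOW-LOCAL typing of record `CellEnergyClausesW`
(`…LagrangianStepCellClauseCutsW`, tenure D24-4 / ✓ ACK 13:04:46Z: «v2 = {stub_cellEnergyT ↦ WNoE, stub_oneLevelL_I with the W hypothesis, …} composed
through `cellEnergyClausesW_of_noE` + `chainLower_of_pieces_IS`»; the clause is passed through to the one-level step untouched, so the proof is the same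
text with `CellEnergyClauses ↦ CellEnergyClausesW`).  Infrastructure for route-1's rung leaf F-D1.A0 (a frontier FORMAL rung); NOT a proof of the crux, of
Onsager's conjecture or of anomalous dissipation.  Landed by prover seat `ad-k3l-bookkeeping-p1` g3, 2026-08-28.
-/

set_option linter.dupNamespace false

namespace Summit.AnomalousDissipation.AnomalousDissipation.Theorems.SolenoidalFractalHomogenisation.LagrangianStep

open Literature.Analysis Literature.Analysis.FluidPDE Literature.Analysis.FunctionSpaces
open MeasureTheory Set Filter
open scoped ENNReal NNReal InnerProductSpace

noncomputable section

/-- **THE RE-PLUMBED GLUE, PROVED (`chainLower_of_pieces` p629119 through the interval package).**  From the base estimate (`stub_baseT` text),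
the window-agnostic one-level step `stub_oneLevelL_I` and the data output by `stub_cellLawW_I` / `stub_cellEnergyT`: `ChainLower E` for every
carrier on the template — window conjunct by `chainTensorF_nearIso`, the two image facts by `chainImage_nearIso`, existence by `existsL_tensor`,
`mstar ↦ max mstar m₁` with `m₁` from `TailDefectBound`. -/
theorem chainLower_of_pieces_I
    (hba : ∀ k (E : LatticeShear.LagrangianLatticeCarrier k), E.LPermissible → E.Regular →
    ∀ (m : ℕ) (𝔸 : Torus.Visc4 (Fin 3)) (lo hi : ℝ), 0 < lo → Torus.NearIso 𝔸 lo hi →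
      ∀ (w₀ : VF) (u : ℝ → VF), IsDatum w₀ → TSol E m 𝔸 w₀ u →
        ∀ᵐ t ∂(volume.restrict (Ioo (1/2 : ℝ) 1)),
          (1 - Real.exp (-(4 * Real.pi ^ 2 * lo))) * Torus.vectorL2Sq w₀ ≤ drop w₀ u t)
    (hone : ∀ k (W : Literature.Analysis.FluidPDE.LatticeShear.LatticeWord k) (M : ℝ) (hM : 0 < M) (c : ℝ), 0 < c →
    ∀ (Φ : ℝ → Torus.Visc4 (Fin 3) → Torus.Visc4 (Fin 3)) (lo hi Λ β σ C ν₀ K Cf νf Kf : ℝ),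
      0 < lo → lo ≤ 1 → 1 ≤ hi → 1 < Λ → 0 ≤ β →
      0 < σ → 0 ≤ C → 0 < ν₀ → 0 < K → SlowVectorClauseF W M hM c Φ lo hi Λ β σ C ν₀ K →
      0 ≤ Cf → 0 < νf → 0 < Kf → CellEnergyClauses W M hM c lo hi Λ β Cf νf Kf →
      ∃ ν₁ > (0:ℝ), ∃ K₁ > (0:ℝ), ∃ Λ₀ : ℕ, ∃ θ₀ > (0:ℝ), ∃ C₁ > (0:ℝ), ∃ σ₁ > (0:ℝ),
        ∀ E : Literature.Analysis.FluidPDE.LatticeShear.LagrangianLatticeCarrier k, E.design = W.stretch M hM → E.gain = c → E.nu0 = ν₁ → E.K = K₁ → E.LPermissible → E.Regular → (∀ m, Λ₀ * E.N m ≤ E.N (m + 1)) → (∀ m, E.N m ^ 2 ≤ E.N (m + 1)) → (∀ m, E.cellVisc (m + 1) * ((E.N (m + 1) : ℝ) / E.N m) ^ (1 / 4 : ℝ) ≤ 1) → (∀ m, E.K * ((E.N (m + 1) : ℝ) / E.N m) ^ (1 / 4 : ℝ) ≤ ((E.N (m + 1) : ℝ) / E.N m) * E.cellVisc (m + 1))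 → (∀ m, E.θ (m + 1) * ((E.N (m + 1) : ℝ) / E.N m) ^ (1 / 16 : ℝ) ≤ θ₀) → (∀ m, ((E.N (m + 1) : ℝ) / E.N m) ^ (1 / 16 : ℝ) * E.physPeriod (m + 1) ≤ E.refresh (m + 1)) →
        ∀ R : ℝ≥0, ∃ mstar : ℕ, ∀ m, mstar ≤ m →
          ∀ S : Torus.Visc4 (Fin 3), Torus.OddSmall S β → Torus.NearIso S lo hi →
            Torus.OddSmall (Φ (E.cellVisc (m + 1)) S) β → Torus.NearIso (Φ (E.cellVisc (m + 1)) S) lo hi →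
          ∀ (w₀ : VF), IsDatum w₀ → InClass R w₀ →
          ∀ u v : ℝ → VF, TSol E (m + 1) (E.kbar (m + 1) • S) w₀ u →
            TSol E m (E.kbar m • renormStep (Φ (E.cellVisc (m + 1))) (E.gain / E.cellVisc (m + 1) ^ 2) S) w₀ v →
            ∀ᵐ t ∂(volume.restrict (Ioo (1/2 : ℝ) 1)),
              (1 - C₁ * ((E.N m : ℝ) / E.N (m + 1)) ^ σ₁) * drop w₀ v t ≤ drop w₀ u t) :
    ∀ k (W : Literature.Analysis.FluidPDE.LatticeShear.LatticeWord k) (M : ℝ) (hM : 0 < M) (c : ℝ), 0 < c →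
    ∀ (Φ : ℝ → Torus.Visc4 (Fin 3) → Torus.Visc4 (Fin 3)) (μ : ℝ → ℝ) (Sstar : Torus.Visc4 (Fin 3))
      (slo shi lam₀ Λ Λc Λ' lo hi ΛV β σ C ν₀ K Cf νf Kf : ℝ),
      0 < lo → lo ≤ 1 → 1 ≤ hi → 1 < ΛV → 0 ≤ β → IntervalWindowFamily Φ μ Sstar slo shi lam₀ Λ Λc Λ' β lo hi ΛV →
      0 < σ → 0 ≤ C → 0 < ν₀ → 0 < K → SlowVectorClauseF W M hM c Φ lo hi ΛV β σ C ν₀ K →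
      0 ≤ Cf → 0 < νf → 0 < Kf → CellEnergyClauses W M hM c lo hi ΛV β Cf νf Kf →
      ∃ ν₁ > (0:ℝ), ∃ K₁ > (0:ℝ), ∃ Λ₀ : ℕ, ∃ θ₀ > (0:ℝ),
        ∀ E : Literature.Analysis.FluidPDE.LatticeShear.LagrangianLatticeCarrier k, E.design = W.stretch M hM → E.gain = c → E.nu0 = ν₁ → E.K = K₁ → E.LPermissible → E.Regular → (∀ m, Λ₀ * E.N m ≤ E.N (m + 1)) → (∀ m, E.N m ^ 2 ≤ E.N (m + 1)) → (∀ m, E.cellVisc (m + 1) * ((E.N (m + 1) : ℝ) / E.N m) ^ (1 / 4 : ℝ) ≤ 1) → (∀ m, E.K * ((E.N (m + 1) : ℝ) / E.N m) ^ (1 / 4 : ℝ) ≤ ((E.N (m + 1) : ℝ) / E.N m) * E.cellVisc (m + 1)) → (∀ m, E.θ (m + 1) * ((E.N (m + 1) : ℝ) / E.N m) ^ (1 / 16 : ℝ) ≤ θ₀) → (∀ m, ((E.N (m + 1) : ℝ) / E.N m) ^ (1 / 16 : ℝ) * E.physPeriod (m + 1) ≤ E.refresh (m + 1)) → ChainLower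 E := by
  intro k W M hM c hc Φ μ Sstar slo shi lam₀ Λ Λc Λ' lo hi ΛV β σ C ν₀ K Cf νf Kf hlo hlo1 hhi1 hΛV hβ hWF hσ hC hν₀ hK hV hCf hνf hKf hEcl
  obtain ⟨ν₁, hν₁, K₁, hK₁, Λ₀, θ₀, hθ₀, C₁, hC₁, σ₁, hσ₁, hlev⟩ :=
    hone k W M hM c hc Φ lo hi ΛV β σ C ν₀ K Cf νf Kf hlo hlo1 hhi1 hΛV hβ hσ hC hν₀ hK hV hCf hνf hKf hEcl
  refine ⟨ν₁, hν₁, K₁, hK₁, Λ₀, θ₀, hθ₀, ?_⟩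
  intro E hW hg hn hK' hP hR h1a h1b h2 h3 h4 h5
  have hlevE := hlev E hW hg hn hK' hP hR h1a h1b h2 h3 h4 h5
  obtain ⟨hwin, hμ, htailB, hslo, hlamc, hΛcΛ, hloc, hhic, _, _, _⟩ := hWF
  obtain ⟨m₁, htail⟩ := htailB k E hP h1b h2
  have hwinT : ∀ j m, m₁ ≤ m → m ≤ j → Torus.NearIso (chainTensorF E Φ j m) (E.kbar m * lo) (E.kbar m * hi) :=
    fun j m hm hmj => (chainTensorF_nearIso E hβ hslo.le hwin hμ hΛcΛ hlo.le hloc hhic htail hm hmj).2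
  refine ⟨lo, hlo, hi, C₁, hC₁, σ₁, hσ₁, ?_⟩
  intro R
  obtain ⟨mstar, hm⟩ := hlevE R
  refine ⟨max mstar m₁, fun j hj => ⟨chainTensorF E Φ j, chainTensorF_top E Φ j,
    fun m hm1 hm2 => hwinT j m ((le_max_right _ _).trans hm1) hm2, ?_⟩⟩
  intro m hm1 hm2 w₀ hdat hcl
  have hm1' : m₁ ≤ m := (le_max_right _ _).trans hm1
  have hm1'' : mstar ≤ m := (le_max_left _ _).trans hm1
  -- the level-(m+1) shape and its image through `Φ (cellVisc (m+1))`
  obtain ⟨⟨hSo, hSn⟩, _⟩ := chainTensorF_nearIso E hβ hslo.le hwin hμ hΛcΛ hlo.le hloc hhic htail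
    (show m₁ ≤ m + 1 by omega) (show m + 1 ≤ j by omega)
  obtain ⟨hΦo, hΦn⟩ := chainImage_nearIso E hβ hslo.le hwin hμ hΛcΛ hlo.le hloc hhic htail hm1' hm2
  have hstep := hm m hm1'' _ hSo hSn hΦo hΦn w₀ hdat hcl
  refine ⟨existsL_tensor E hR m (hwinT j m hm1' hm2.le) (mul_pos (E.kbar_pos m) hlo) w₀ hdat, ?_⟩
  intro u v hu hv
  have hv' := hv
  rw [chainTensorF_succ E Φ hm2] at hv'
  have hu' : TSol E (m + 1) (E.kbar (m + 1) • shapeSeqF (fun i => Φ (E.cellVisc i)) (fun i => E.gain / E.cellVisc i ^ 2) j (j - (m + 1))) w₀ u := hu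
  have hcmp := hstep u v hu' hv'
  have hbase := hba k E hP hR m (chainTensorF E Φ j m) (E.kbar m * lo) (E.kbar m * hi)
    (mul_pos (E.kbar_pos m) hlo) (hwinT j m hm1' hm2.le) w₀ v hdat hv
  have hcb : 0 ≤ 1 - Real.exp (-(4 * Real.pi ^ 2 * (E.kbar m * lo))) := by
    have hexp : Real.exp (-(4 * Real.pi ^ 2 * (E.kbar m * lo))) < 1 := by
      rw [Real.exp_lt_one_iff]
      have : 0 < 4 * Real.pi ^ 2 * (E.kbar m * lo) := by
        have := E.kbar_pos m
        positivity
      linarith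
    linarith
  have hL2 : 0 ≤ Torus.vectorL2Sq w₀ := by
    show 0 ≤ ∫ x, ‖w₀ x‖ ^ 2
    exact integral_nonneg fun x => by positivity
  filter_upwards [hcmp, hbase] with t h1 h2
  exact ⟨le_trans (mul_nonneg hcb hL2) h2, h1⟩

/-- **THE RE-PLUMBED GLUE FOR THE v2 TYPING OF RECORD, PROVED** — `chainLower_of_pieces` (p629119) through `SectorialIntervalWindowFamily`:
base estimate (`stub_baseT` text) + the UNCHANGED window-agnostic `stub_oneLevelL_I` + the data of `stub_cellLawW_IS` / `stub_cellEnergyT` ⟹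
`ChainLower E` on the template; window conjunct and the two image facts by `chainTensorF_nearIsoS` / `chainImage_nearIsoS` (+ `OddSmall.mono`
from `τc·hi` to `β`), existence by `existsL_tensor`, `mstar ↦ max mstar m₁`. -/
theorem chainLower_of_pieces_IS
    (hba : ∀ k (E : LatticeShear.LagrangianLatticeCarrier k), E.LPermissible → E.Regular →
    ∀ (m : ℕ) (𝔸 : Torus.Visc4 (Fin 3)) (lo hi : ℝ), 0 < lo → Torus.NearIso 𝔸 lo hi →
      ∀ (w₀ : VF) (u : ℝ → VF), IsDatum w₀ → TSol E m 𝔸 w₀ u →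
        ∀ᵐ t ∂(volume.restrict (Ioo (1/2 : ℝ) 1)),
          (1 - Real.exp (-(4 * Real.pi ^ 2 * lo))) * Torus.vectorL2Sq w₀ ≤ drop w₀ u t)
    (hone : ∀ k (W : Literature.Analysis.FluidPDE.LatticeShear.LatticeWord k) (M : ℝ) (hM : 0 < M) (c : ℝ), 0 < c →
    ∀ (Φ : ℝ → Torus.Visc4 (Fin 3) → Torus.Visc4 (Fin 3)) (lo hi Λ β σ C ν₀ K Cf νf Kf : ℝ),
      0 < lo → lo ≤ 1 → 1 ≤ hi → 1 < Λ → 0 ≤ β →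
      0 < σ → 0 ≤ C → 0 < ν₀ → 0 < K → SlowVectorClauseF W M hM c Φ lo hi Λ β σ C ν₀ K →
      0 ≤ Cf → 0 < νf → 0 < Kf → CellEnergyClauses W M hM c lo hi Λ β Cf νf Kf →
      ∃ ν₁ > (0:ℝ), ∃ K₁ > (0:ℝ), ∃ Λ₀ : ℕ, ∃ θ₀ > (0:ℝ), ∃ C₁ > (0:ℝ), ∃ σ₁ > (0:ℝ),
        ∀ E : Literature.Analysis.FluidPDE.LatticeShear.LagrangianLatticeCarrier k, E.design = W.stretch M hM → E.gain = c → E.nu0 = ν₁ → E.K = K₁ → E.LPermissible → E.Regular → (∀ m, Λ₀ * E.N m ≤ E.N (m + 1)) → (∀ m, E.N m ^ 2 ≤ E.N (m + 1)) → (∀ m, E.cellVisc (m + 1) * ((E.N (m + 1) : ℝ) / E.N m) ^ (1 / 4 : ℝ) ≤ 1) → (∀ m, E.K * ((E.N (m + 1) : ℝ) / E.N m) ^ (1 / 4 : ℝ) ≤ ((E.N (m + 1) : ℝ) / E.N m) * E.cellVisc (m + 1)) → (∀ m, E.θ (m + 1) * ((E.N (m + 1) : ℝ) / E.N m) ^ (1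 / 16 : ℝ) ≤ θ₀) → (∀ m, ((E.N (m + 1) : ℝ) / E.N m) ^ (1 / 16 : ℝ) * E.physPeriod (m + 1) ≤ E.refresh (m + 1)) →
        ∀ R : ℝ≥0, ∃ mstar : ℕ, ∀ m, mstar ≤ m →
          ∀ S : Torus.Visc4 (Fin 3), Torus.OddSmall S β → Torus.NearIso S lo hi →
            Torus.OddSmall (Φ (E.cellVisc (m + 1)) S) β → Torus.NearIso (Φ (E.cellVisc (m + 1)) S) lo hi →
          ∀ (w₀ : VF), IsDatum w₀ → InClass R w₀ →
          ∀ u v : ℝ → VF, TSol E (m + 1) (E.kbar (m + 1) • S) w₀ u →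
            TSol E m (E.kbar m • renormStep (Φ (E.cellVisc (m + 1))) (E.gain / E.cellVisc (m + 1) ^ 2) S) w₀ v →
            ∀ᵐ t ∂(volume.restrict (Ioo (1/2 : ℝ) 1)),
              (1 - C₁ * ((E.N m : ℝ) / E.N (m + 1)) ^ σ₁) * drop w₀ v t ≤ drop w₀ u t) :
    ∀ k (W : Literature.Analysis.FluidPDE.LatticeShear.LatticeWord k) (M : ℝ) (hM : 0 < M) (c : ℝ), 0 < c →
    ∀ (Φ : ℝ → Torus.Visc4 (Fin 3) → Torus.Visc4 (Fin 3)) (μ : ℝ → ℝ) (Sstar : Torus.Visc4 (Fin 3))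
      (slo shi lam₀ Λ Λc Λ' τlo τhi τc lo hi ΛV β σ C ν₀ K Cf νf Kf : ℝ),
      0 < lo → lo ≤ 1 → 1 ≤ hi → 1 < ΛV → 0 ≤ β → SectorialIntervalWindowFamily Φ μ Sstar slo shi lam₀ Λ Λc Λ' τlo τhi τc β lo hi ΛV →
      0 < σ → 0 ≤ C → 0 < ν₀ → 0 < K → SlowVectorClauseF W M hM c Φ lo hi ΛV β σ C ν₀ K →
      0 ≤ Cf → 0 < νf → 0 < Kf → CellEnergyClauses W M hM c lo hi ΛV β Cf νf Kf →
      ∃ ν₁ > (0:ℝ), ∃ K₁ > (0:ℝ), ∃ Λ₀ : ℕ, ∃ θ₀ > (0:ℝ),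
        ∀ E : Literature.Analysis.FluidPDE.LatticeShear.LagrangianLatticeCarrier k, E.design = W.stretch M hM → E.gain = c → E.nu0 = ν₁ → E.K = K₁ → E.LPermissible → E.Regular → (∀ m, Λ₀ * E.N m ≤ E.N (m + 1)) → (∀ m, E.N m ^ 2 ≤ E.N (m + 1)) → (∀ m, E.cellVisc (m + 1) * ((E.N (m + 1) : ℝ) / E.N m) ^ (1 / 4 : ℝ) ≤ 1) → (∀ m, E.K * ((E.N (m + 1) : ℝ) / E.N m) ^ (1 / 4 : ℝ) ≤ ((E.N (m + 1) : ℝ) / E.N m) * E.cellVisc (m + 1)) → (∀ m, E.θ (m + 1) * ((E.N (m + 1) : ℝ) / E.N m) ^ (1 / 16 : ℝ) ≤ θ₀) → (∀ m, ((E.N (m + 1) : ℝ) / E.N m) ^ (1 / 16 : ℝ) * E.physPeriod (m + 1) ≤ E.refresh (m + 1)) → ChainLower E := by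
  intro k W M hM c hc Φ μ Sstar slo shi lam₀ Λ Λc Λ' τlo τhi τc lo hi ΛV β σ C ν₀ K Cf νf Kf hlo hlo1 hhi1 hΛV hβ hWF hσ hC hν₀ hK hV hCf hνf hKf hEcl
  obtain ⟨ν₁, hν₁, K₁, hK₁, Λ₀, θ₀, hθ₀, C₁, hC₁, σ₁, hσ₁, hlev⟩ :=
    hone k W M hM c hc Φ lo hi ΛV β σ C ν₀ K Cf νf Kf hlo hlo1 hhi1 hΛV hβ hσ hC hν₀ hK hV hCf hνf hKf hEcl
  refine ⟨ν₁, hν₁, K₁, hK₁, Λ₀, θ₀, hθ₀, ?_⟩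
  intro E hW hg hn hK' hP hR h1a h1b h2 h3 h4 h5
  have hlevE := hlev E hW hg hn hK' hP hR h1a h1b h2 h3 h4 h5
  obtain ⟨hwin, hμ, htailB, hslo, hlamc, hΛcΛ, hloc, hhic, _, _, _, hτc, hτc0, hτcβ, _⟩ := hWF
  obtain ⟨m₁, htail⟩ := htailB k E hP h1b h2
  have hhi0 : 0 ≤ hi := zero_le_one.trans hhi1
  have hτhi : 0 ≤ τc * hi := mul_nonneg hτc0 hhi0
  have hwinT : ∀ j m, m₁ ≤ m → m ≤ j → Torus.NearIso (chainTensorF E Φ j m) (E.kbar m * lo) (E.kbar m * hi) :=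
    fun j m hm hmj => (chainTensorF_nearIsoS E hslo.le hτc hτc0 hwin hμ hΛcΛ hlo.le hloc hhic htail hm hmj).2
  refine ⟨lo, hlo, hi, C₁, hC₁, σ₁, hσ₁, ?_⟩
  intro R
  obtain ⟨mstar, hm⟩ := hlevE R
  refine ⟨max mstar m₁, fun j hj => ⟨chainTensorF E Φ j, chainTensorF_top E Φ j,
    fun m hm1 hm2 => hwinT j m ((le_max_right _ _).trans hm1) hm2, ?_⟩⟩
  intro m hm1 hm2 w₀ hdat hcl
  have hm1' : m₁ ≤ m := (le_max_right _ _).trans hm1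
  have hm1'' : mstar ≤ m := (le_max_left _ _).trans hm1
  obtain ⟨⟨hSo, hSn⟩, _⟩ := chainTensorF_nearIsoS E hslo.le hτc hτc0 hwin hμ hΛcΛ hlo.le hloc hhic htail
    (show m₁ ≤ m + 1 by omega) (show m + 1 ≤ j by omega)
  obtain ⟨hΦo, hΦn⟩ := chainImage_nearIsoS E hslo.le hτc hτc0 hwin hμ hΛcΛ hlo.le hloc hhic htail hm1' hm2
  have hstep := hm m hm1'' _ (hSo.mono hτhi hτcβ) hSn (hΦo.mono hτhi hτcβ) hΦn w₀ hdat hcl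
  refine ⟨existsL_tensor E hR m (hwinT j m hm1' hm2.le) (mul_pos (E.kbar_pos m) hlo) w₀ hdat, ?_⟩
  intro u v hu hv
  have hv' := hv
  rw [chainTensorF_succ E Φ hm2] at hv'
  have hu' : TSol E (m + 1) (E.kbar (m + 1) • shapeSeqF (fun i => Φ (E.cellVisc i)) (fun i => E.gain / E.cellVisc i ^ 2) j (j - (m + 1))) w₀ u := hu
  have hcmp := hstep u v hu' hv'
  have hbase := hba k E hP hR m (chainTensorF E Φ j m) (E.kbar m * lo) (E.kbar m * hi)
    (mul_pos (E.kbar_pos m) hlo) (hwinT j m hm1' hm2.le) w₀ v hdat hv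
  have hcb : 0 ≤ 1 - Real.exp (-(4 * Real.pi ^ 2 * (E.kbar m * lo))) := by
    have hexp : Real.exp (-(4 * Real.pi ^ 2 * (E.kbar m * lo))) < 1 := by
      rw [Real.exp_lt_one_iff]
      have : 0 < 4 * Real.pi ^ 2 * (E.kbar m * lo) := by
        have := E.kbar_pos m
        positivity
      linarith
    linarith
  have hL2 : 0 ≤ Torus.vectorL2Sq w₀ := by
    show 0 ≤ ∫ x, ‖w₀ x‖ ^ 2
    exact integral_nonneg fun x => by positivity
  filter_upwards [hcmp, hbase] with t h1 h2
  exact ⟨le_trans (mul_nonneg hcb hL2) h2, h1⟩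

/-- **The v2 glue in the WINDOW-LOCAL cell-energy typing of record** (tenure D24-4 / ✓ ACK 13:04:46Z): `chainLower_of_pieces_IS` verbatim with
`CellEnergyClauses ↦ CellEnergyClausesW` in the one-level hypothesis (`stub_oneLevelL_I` with the W hypothesis) and in the data binder (the output of
`cellEnergyClausesW_of_noE stub_cellEnergyT`); the clause is passed through to the one-level step untouched. -/
theorem chainLower_of_pieces_ISW
    (hba : ∀ k (E : LatticeShear.LagrangianLatticeCarrier k), E.LPermissible → E.Regular →
    ∀ (m : ℕ) (𝔸 : Torus.Visc4 (Fin 3)) (lo hi : ℝ), 0 < lo → Torus.NearIso 𝔸 lo hi →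
      ∀ (w₀ : VF) (u : ℝ → VF), IsDatum w₀ → TSol E m 𝔸 w₀ u →
        ∀ᵐ t ∂(volume.restrict (Ioo (1/2 : ℝ) 1)),
          (1 - Real.exp (-(4 * Real.pi ^ 2 * lo))) * Torus.vectorL2Sq w₀ ≤ drop w₀ u t)
    (hone : ∀ k (W : Literature.Analysis.FluidPDE.LatticeShear.LatticeWord k) (M : ℝ) (hM : 0 < M) (c : ℝ), 0 < c →
    ∀ (Φ : ℝ → Torus.Visc4 (Fin 3) → Torus.Visc4 (Fin 3)) (lo hi Λ β σ C ν₀ K Cf νf Kf : ℝ),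
      0 < lo → lo ≤ 1 → 1 ≤ hi → 1 < Λ → 0 ≤ β →
      0 < σ → 0 ≤ C → 0 < ν₀ → 0 < K → SlowVectorClauseF W M hM c Φ lo hi Λ β σ C ν₀ K →
      0 ≤ Cf → 0 < νf → 0 < Kf → CellEnergyClausesW W M hM c lo hi Λ β Cf νf Kf →
      ∃ ν₁ > (0:ℝ), ∃ K₁ > (0:ℝ), ∃ Λ₀ : ℕ, ∃ θ₀ > (0:ℝ), ∃ C₁ > (0:ℝ), ∃ σ₁ > (0:ℝ),
        ∀ E : Literature.Analysis.FluidPDE.LatticeShear.LagrangianLatticeCarrier k, E.design = W.stretch M hM → E.gain = c → E.nu0 = ν₁ → E.K = K₁ → E.LPermissible → E.Regular → (∀ m, Λ₀ * E.N m ≤ E.N (m + 1)) → (∀ m, E.N m ^ 2 ≤ E.N (m + 1)) → (∀ m, E.cellVisc (m + 1) * ((E.N (m + 1) : ℝ) / E.N m) ^ (1 / 4 : ℝ) ≤ 1) → (∀ m, E.K * ((E.N (m + 1) : ℝ) / E.N m) ^ (1 / 4 : ℝ) ≤ ((E.N (m + 1) : ℝ) / E.N m) * E.cellVisc (m + 1))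 → (∀ m, E.θ (m + 1) * ((E.N (m + 1) : ℝ) / E.N m) ^ (1 / 16 : ℝ) ≤ θ₀) → (∀ m, ((E.N (m + 1) : ℝ) / E.N m) ^ (1 / 16 : ℝ) * E.physPeriod (m + 1) ≤ E.refresh (m + 1)) →
        ∀ R : ℝ≥0, ∃ mstar : ℕ, ∀ m, mstar ≤ m →
          ∀ S : Torus.Visc4 (Fin 3), Torus.OddSmall S β → Torus.NearIso S lo hi →
            Torus.OddSmall (Φ (E.cellVisc (m + 1)) S) β → Torus.NearIso (Φ (E.cellVisc (m + 1)) S) lo hi →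
          ∀ (w₀ : VF), IsDatum w₀ → InClass R w₀ →
          ∀ u v : ℝ → VF, TSol E (m + 1) (E.kbar (m + 1) • S) w₀ u →
            TSol E m (E.kbar m • renormStep (Φ (E.cellVisc (m + 1))) (E.gain / E.cellVisc (m + 1) ^ 2) S) w₀ v →
            ∀ᵐ t ∂(volume.restrict (Ioo (1/2 : ℝ) 1)),
              (1 - C₁ * ((E.N m : ℝ) / E.N (m + 1)) ^ σ₁) * drop w₀ v t ≤ drop w₀ u t) :
    ∀ k (W : Literature.Analysis.FluidPDE.LatticeShear.LatticeWord k) (M : ℝ) (hM : 0 < M) (c : ℝ), 0 < c →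
    ∀ (Φ : ℝ → Torus.Visc4 (Fin 3) → Torus.Visc4 (Fin 3)) (μ : ℝ → ℝ) (Sstar : Torus.Visc4 (Fin 3))
      (slo shi lam₀ Λ Λc Λ' τlo τhi τc lo hi ΛV β σ C ν₀ K Cf νf Kf : ℝ),
      0 < lo → lo ≤ 1 → 1 ≤ hi → 1 < ΛV → 0 ≤ β → SectorialIntervalWindowFamily Φ μ Sstar slo shi lam₀ Λ Λc Λ' τlo τhi τc β lo hi ΛV →
      0 < σ → 0 ≤ C → 0 < ν₀ → 0 < K → SlowVectorClauseF W M hM c Φ lo hi ΛV β σ C ν₀ K →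
      0 ≤ Cf → 0 < νf → 0 < Kf → CellEnergyClausesW W M hM c lo hi ΛV β Cf νf Kf →
      ∃ ν₁ > (0:ℝ), ∃ K₁ > (0:ℝ), ∃ Λ₀ : ℕ, ∃ θ₀ > (0:ℝ),
        ∀ E : Literature.Analysis.FluidPDE.LatticeShear.LagrangianLatticeCarrier k, E.design = W.stretch M hM → E.gain = c → E.nu0 = ν₁ → E.K = K₁ → E.LPermissible → E.Regular → (∀ m, Λ₀ * E.N m ≤ E.N (m + 1)) → (∀ m, E.N m ^ 2 ≤ E.N (m + 1)) → (∀ m, E.cellVisc (m + 1) * ((E.N (m + 1) : ℝ) / E.N m) ^ (1 / 4 : ℝ) ≤ 1) → (∀ m, E.K * ((E.N (m + 1) : ℝ) / E.N m) ^ (1 / 4 : ℝ) ≤ ((E.N (m + 1) : ℝ) / E.N m) * E.cellVisc (m + 1)) → (∀ m, E.θ (m + 1) * ((E.N (m + 1) : ℝ) / E.N m) ^ (1 / 16 : ℝ) ≤ θ₀) → (∀ m, ((E.N (m + 1) : ℝ) / E.N m) ^ (1 / 16 : ℝ) * E.physPeriod (m + 1) ≤ E.refresh (m + 1)) → ChainLower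 E := by
  intro k W M hM c hc Φ μ Sstar slo shi lam₀ Λ Λc Λ' τlo τhi τc lo hi ΛV β σ C ν₀ K Cf νf Kf hlo hlo1 hhi1 hΛV hβ hWF hσ hC hν₀ hK hV hCf hνf hKf hEcl
  obtain ⟨ν₁, hν₁, K₁, hK₁, Λ₀, θ₀, hθ₀, C₁, hC₁, σ₁, hσ₁, hlev⟩ :=
    hone k W M hM c hc Φ lo hi ΛV β σ C ν₀ K Cf νf Kf hlo hlo1 hhi1 hΛV hβ hσ hC hν₀ hK hV hCf hνf hKf hEcl
  refine ⟨ν₁, hν₁, K₁, hK₁, Λ₀, θ₀, hθ₀, ?_⟩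
  intro E hW hg hn hK' hP hR h1a h1b h2 h3 h4 h5
  have hlevE := hlev E hW hg hn hK' hP hR h1a h1b h2 h3 h4 h5
  obtain ⟨hwin, hμ, htailB, hslo, hlamc, hΛcΛ, hloc, hhic, _, _, _, hτc, hτc0, hτcβ, _⟩ := hWF
  obtain ⟨m₁, htail⟩ := htailB k E hP h1b h2
  have hhi0 : 0 ≤ hi := zero_le_one.trans hhi1
  have hτhi : 0 ≤ τc * hi := mul_nonneg hτc0 hhi0
  have hwinT : ∀ j m, m₁ ≤ m → m ≤ j → Torus.NearIso (chainTensorF E Φ j m) (E.kbar m * lo) (E.kbar m * hi) :=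
    fun j m hm hmj => (chainTensorF_nearIsoS E hslo.le hτc hτc0 hwin hμ hΛcΛ hlo.le hloc hhic htail hm hmj).2
  refine ⟨lo, hlo, hi, C₁, hC₁, σ₁, hσ₁, ?_⟩
  intro R
  obtain ⟨mstar, hm⟩ := hlevE R
  refine ⟨max mstar m₁, fun j hj => ⟨chainTensorF E Φ j, chainTensorF_top E Φ j,
    fun m hm1 hm2 => hwinT j m ((le_max_right _ _).trans hm1) hm2, ?_⟩⟩
  intro m hm1 hm2 w₀ hdat hcl
  have hm1' : m₁ ≤ m := (le_max_right _ _).trans hm1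
  have hm1'' : mstar ≤ m := (le_max_left _ _).trans hm1
  obtain ⟨⟨hSo, hSn⟩, _⟩ := chainTensorF_nearIsoS E hslo.le hτc hτc0 hwin hμ hΛcΛ hlo.le hloc hhic htail
    (show m₁ ≤ m + 1 by omega) (show m + 1 ≤ j by omega)
  obtain ⟨hΦo, hΦn⟩ := chainImage_nearIsoS E hslo.le hτc hτc0 hwin hμ hΛcΛ hlo.le hloc hhic htail hm1' hm2
  have hstep := hm m hm1'' _ (hSo.mono hτhi hτcβ) hSn (hΦo.mono hτhi hτcβ) hΦn w₀ hdat hcl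
  refine ⟨existsL_tensor E hR m (hwinT j m hm1' hm2.le) (mul_pos (E.kbar_pos m) hlo) w₀ hdat, ?_⟩
  intro u v hu hv
  have hv' := hv
  rw [chainTensorF_succ E Φ hm2] at hv'
  have hu' : TSol E (m + 1) (E.kbar (m + 1) • shapeSeqF (fun i => Φ (E.cellVisc i)) (fun i => E.gain / E.cellVisc i ^ 2) j (j - (m + 1))) w₀ u := hu
  have hcmp := hstep u v hu' hv'
  have hbase := hba k E hP hR m (chainTensorF E Φ j m) (E.kbar m * lo) (E.kbar m * hi)
    (mul_pos (E.kbar_pos m) hlo) (hwinT j m hm1' hm2.le) w₀ v hdat hv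
  have hcb : 0 ≤ 1 - Real.exp (-(4 * Real.pi ^ 2 * (E.kbar m * lo))) := by
    have hexp : Real.exp (-(4 * Real.pi ^ 2 * (E.kbar m * lo))) < 1 := by
      rw [Real.exp_lt_one_iff]
      have : 0 < 4 * Real.pi ^ 2 * (E.kbar m * lo) := by
        have := E.kbar_pos m
        positivity
      linarith
    linarith
  have hL2 : 0 ≤ Torus.vectorL2Sq w₀ := by
    show 0 ≤ ∫ x, ‖w₀ x‖ ^ 2
    exact integral_nonneg fun x => by positivity
  filter_upwards [hcmp, hbase] with t h1 h2
  exact ⟨le_trans (mul_nonneg hcb hL2) h2, h1⟩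

end

end Summit.AnomalousDissipation.AnomalousDissipation.Theorems.SolenoidalFractalHomogenisation.LagrangianStep
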